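import Literature.Probability.Percolation.DifferenceChainReturns
import Mathlib.Analysis.SpecificLimits.Basic
import HarnessLib

/-!
# Visits of the difference chain to `S₂`: `p₂ ≤ t(p_d)` (BDNS Lemma 4.1, item 1) in finite horizon

Topic `Literature/Probability/Percolation`.  Sorry-free, no named facts.  This file bounds the
renewal parameter `r` of `ShieldedPairWeights.phiW_zero_le` — the probability `hS d N s` that the
difference chain started at `s ∈ S₂` makes its first visit to `{0} ∪ S₂` in `S₂` — following the
proof of Lemma 4.1 of Bock–Damron–Newman–Sidoravicius, *Percolation of finite clusters and shielded
paths*, J. Stat. Phys. 179 (2020), §4: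

* `visA d n z j = P_z(#{1 ≤ k ≤ n : D_k ∈ S₂} ≥ j)` (first-step recursion), its symmetry under
  coordinate permutations (`visA_comp_perm`, all `S₂` states are equivalent, `visA_eq_of_isS2`),
  `E_z #O_n = Σ_{j ≥ 1} P_z(#O_n ≥ j)` (`sum_visA_eq_esum`);
* the LOWER renewal bound (`visA_lower`): `P_z(#O_{n+N} ≥ j+2) ≥ P_z(#O_n ≥ j+1) · π_N` with
  `π_N = P_s(#O_N ≥ 1)` (`s ∈ S₂`), and `P_0(#O_M ≥ 1) = 1 - d^{-M}` (`visA_origin_one`), so that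
  `Σ_{j<J} π_N^j ≤ E_0 #O_∞ ≤ O⁺` (`geom_sum_visA_le`) — BDNS (4.6): `P(#O = k) = (1 - p₂)p₂^{k-1}`,
  `E #O = 1/(1 - p₂)`;
* **`visA_S2_le`**: `π_N ≤ 1 - 1/O⁺` and **`hS_le_of_retProb_le`**:
  `hS d N s ≤ 1 - (1 - ρ)/(d²ρ - d) - 1/d² = t(ρ) - 1/d²` for all `N` and `s ∈ S₂`, whenever
  `P_0(τ ≤ n) ≤ ρ` for all `n` with `1/d < ρ < 1` (`t` as in BDNS Lemma 4.1 / (4.13); the `- 1/d²` is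
  the step `f(q) = … + p₂ - 1/d²` of (3.14): returns to `S₂` through `0` are accounted separately).

## References

* B. Bock, M. Damron, C. M. Newman, V. Sidoravicius, J. Stat. Phys. 179 (2020) 789–807,
  arXiv:1811.01678, §4, Lemma 4.1 (item 1) and (4.4)–(4.6); §3 (3.14). [BockEtAl2020]
-/

noncomputable section

namespace Literature.Probability.Percolation

open Finset Literature.Probability.LatticeModels

variable {d : ℕ}

/-! ### Coordinate permutations -/

section Perm

variable (σ : Equiv.Perm (Fin d))

/-- `z ∘ σ = 0 ↔ z = 0`. [folklore] -/
theorem comp_perm_eq_zero_iff {z : Site d} : z ∘ σ = 0 ↔ z = 0 := by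
  constructor
  · intro h
    funext i
    have := congrFun h (σ.symm i)
    simpa using this
  · rintro rfl
    rfl

/-- `e_a ∘ σ = e_{σ⁻¹ a}`. [folklore] -/
theorem single_comp_perm (a : Fin d) :
    (Pi.single a (1 : ℤ) : Site d) ∘ σ = Pi.single (σ.symm a) 1 := by
  funext i
  simp only [Function.comp_apply, Pi.single_apply, Equiv.eq_symm_apply]

/-- `S₂` is invariant under coordinate permutations. [folklore] -/
theorem isS2_comp_perm_iff {z : Site d} : IsS2 (z ∘ σ) ↔ IsS2 z := by
  constructor
  · rintro ⟨c, c', hne, h⟩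
    refine ⟨σ c, σ c', fun h' => hne (σ.injective h'), ?_⟩
    funext i
    have := congrFun h (σ.symm i)
    simp only [Function.comp_apply, Equiv.apply_symm_apply, Pi.sub_apply, Pi.single_apply] at this
    rw [this]
    simp only [Pi.sub_apply, Pi.single_apply, Equiv.symm_apply_eq]
  · rintro ⟨c, c', hne, rfl⟩
    refine ⟨σ.symm c, σ.symm c', fun h' => hne (σ.symm.injective h'), ?_⟩
    funext i
    simp [Pi.single_apply, Equiv.eq_symm_apply]

/-- One step commutes with permutations: `z∘σ + e_{a'} - e_a = (z + e_{σ a'} - e_{σ a}) ∘ σ`.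
[folklore] -/
theorem step_comp_perm (z : Site d) (a a' : Fin d) :
    z ∘ σ + Pi.single a' 1 - Pi.single a 1 = (z + Pi.single (σ a') 1 - Pi.single (σ a) 1) ∘ σ := by
  funext i
  simp [Pi.single_apply]

/-- Reindexing a double sum by a permutation. [folklore] -/
theorem sum_sum_perm (F : Fin d → Fin d → ℝ) :
    ∑ a : Fin d, ∑ a' : Fin d, F (σ a) (σ a') = ∑ a : Fin d, ∑ a' : Fin d, F a a' := by
  rw [Equiv.sum_comp σ (fun a => ∑ a' : Fin d, F a (σ a'))]
  exact Finset.sum_congr rfl fun a _ => Equiv.sum_comp σ (F a)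

end Perm

/-- Any two `S₂` states are related by a coordinate permutation. [folklore] -/
theorem exists_perm_of_isS2 {s s' : Site d} (hs : IsS2 s) (hs' : IsS2 s') :
    ∃ σ : Equiv.Perm (Fin d), s' = s ∘ σ := by
  obtain ⟨i, j, hij, rfl⟩ := hs
  obtain ⟨i', j', hij', rfl⟩ := hs'
  -- `σ i' = i`, `σ j' = j`
  set τ₁ : Equiv.Perm (Fin d) := Equiv.swap i' i with hτ₁
  set j'' := τ₁ j' with hj''
  set τ₂ : Equiv.Perm (Fin d) := Equiv.swap j'' j with hτ₂
  refine ⟨τ₁.trans τ₂, ?_⟩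
  have h1 : (τ₁.trans τ₂) i' = i := by
    rw [Equiv.trans_apply, hτ₁, Equiv.swap_apply_left, hτ₂]
    refine Equiv.swap_apply_of_ne_of_ne ?_ hij
    rw [hj'', hτ₁]
    intro h
    have : j' = i' := by
      have := congrArg (Equiv.swap i' i) h
      rwa [Equiv.swap_apply_self, Equiv.swap_apply_right, eq_comm] at this
    exact hij' this.symm
  have h2 : (τ₁.trans τ₂) j' = j := by
    rw [Equiv.trans_apply, ← hj'', hτ₂, Equiv.swap_apply_left]
  funext k
  simp only [Function.comp_apply, Pi.sub_apply, Pi.single_apply]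
  have hk1 : ((τ₁.trans τ₂) k = i) ↔ (k = i') := by
    rw [← h1]; exact (τ₁.trans τ₂).injective.eq_iff
  have hk2 : ((τ₁.trans τ₂) k = j) ↔ (k = j') := by
    rw [← h2]; exact (τ₁.trans τ₂).injective.eq_iff
  simp only [hk1, hk2]

/-! ### The distribution of the number of visits to `S₂` -/

/-- `visA d n z j = P_z(#{1 ≤ k ≤ n : D_k ∈ S₂} ≥ j)`. [cite: BockEtAl2020, §4 (4.6)] -/
def visA (d : ℕ) : ℕ → Site d → ℕ → ℝ
  | 0, _, j => if j = 0 then 1 else 0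
  | n + 1, z, j => if j = 0 then 1 else ((d : ℝ) ^ 2)⁻¹ * ∑ a : Fin d, ∑ a' : Fin d,
      if IsS2 (z + Pi.single a' 1 - Pi.single a 1) then visA d n (z + Pi.single a' 1 - Pi.single a 1) (j - 1)
      else visA d n (z + Pi.single a' 1 - Pi.single a 1) j

/-- `P(# ≥ 0) = 1`. [folklore] -/
@[simp] theorem visA_zero_right (n : ℕ) (z : Site d) : visA d n z 0 = 1 := by
  cases n <;> simp [visA]

/-- No visits in no time. [folklore] -/
@[simp] theorem visA_zero_succ (z : Site d) (j : ℕ) : visA d 0 z (j + 1) = 0 := by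
  simp [visA]

/-- Unfolding the recursion. [folklore] -/
theorem visA_succ_succ (n : ℕ) (z : Site d) (j : ℕ) :
    visA d (n + 1) z (j + 1) = ((d : ℝ) ^ 2)⁻¹ * ∑ a : Fin d, ∑ a' : Fin d,
      if IsS2 (z + Pi.single a' 1 - Pi.single a 1) then visA d n (z + Pi.single a' 1 - Pi.single a 1) j
      else visA d n (z + Pi.single a' 1 - Pi.single a 1) (j + 1) := by
  show (if j + 1 = 0 then (1 : ℝ) else _) = _
  rw [if_neg (Nat.succ_ne_zero j), Nat.add_sub_cancel]

/-- `0 ≤ visA ≤ 1`. [folklore] -/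
theorem visA_mem : ∀ (n : ℕ) (z : Site d) (j : ℕ), 0 ≤ visA d n z j ∧ visA d n z j ≤ 1
  | n, z, 0 => by simp
  | 0, z, j + 1 => by simp
  | n + 1, z, j + 1 => by
    rw [visA_succ_succ]
    constructor
    · refine mul_nonneg (by positivity) (Finset.sum_nonneg fun a _ => Finset.sum_nonneg fun a' _ => ?_)
      split_ifs
      · exact (visA_mem n _ _).1
      · exact (visA_mem n _ _).1
    · rcases Nat.eq_zero_or_pos d with hd | hd
      · subst hd
        simp
      · have hd0 : (0 : ℝ) < d := by exact_mod_cast hd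
        calc ((d : ℝ) ^ 2)⁻¹ * ∑ a : Fin d, ∑ a' : Fin d, _
            ≤ ((d : ℝ) ^ 2)⁻¹ * ∑ _a : Fin d, ∑ _a' : Fin d, (1 : ℝ) := by
              refine mul_le_mul_of_nonneg_left
                (Finset.sum_le_sum fun a _ => Finset.sum_le_sum fun a' _ => ?_) (by positivity)
              split_ifs
              · exact (visA_mem n _ _).2
              · exact (visA_mem n _ _).2
          _ = 1 := by
              simp only [Finset.sum_const, Finset.card_univ, Fintype.card_fin, nsmul_eq_mul, mul_one]
              field_simp

/-- `visA ≥ 0`. [folklore] -/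
theorem visA_nonneg (n : ℕ) (z : Site d) (j : ℕ) : 0 ≤ visA d n z j := (visA_mem n z j).1

/-- `visA ≤ 1`. [folklore] -/
theorem visA_le_one (n : ℕ) (z : Site d) (j : ℕ) : visA d n z j ≤ 1 := (visA_mem n z j).2

/-- Monotone in the counter: `P(# ≥ j+1) ≤ P(# ≥ j)`. [folklore] -/
theorem visA_succ_le : ∀ (n : ℕ) (z : Site d) (j : ℕ), visA d n z (j + 1) ≤ visA d n z j
  | 0, z, j => by rw [visA_zero_succ]; exact visA_nonneg _ _ _
  | n + 1, z, 0 => by rw [visA_zero_right]; exact visA_le_one _ _ _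
  | n + 1, z, j + 1 => by
    rw [visA_succ_succ, visA_succ_succ]
    refine mul_le_mul_of_nonneg_left (Finset.sum_le_sum fun a _ => Finset.sum_le_sum fun a' _ => ?_)
      (by positivity)
    split_ifs
    · exact visA_succ_le n _ _
    · exact visA_succ_le n _ _

/-- At most `n` visits in `n` steps. [folklore] -/
theorem visA_eq_zero_of_lt : ∀ (n : ℕ) (z : Site d) (j : ℕ), n < j → visA d n z j = 0
  | 0, z, j, h => by
    cases j with
    | zero => omega
    | succ j => simp
  | n + 1, z, j, h => by
    cases j with
    | zero => omega
    | succ j =>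
      rw [visA_succ_succ]
      refine mul_eq_zero_of_right _ (Finset.sum_eq_zero fun a _ => Finset.sum_eq_zero fun a' _ => ?_)
      split_ifs
      · exact visA_eq_zero_of_lt n _ j (by omega)
      · exact visA_eq_zero_of_lt n _ (j + 1) (by omega)

/-- Monotone in time. [folklore] -/
theorem visA_le_succ : ∀ (n : ℕ) (z : Site d) (j : ℕ), visA d n z j ≤ visA d (n + 1) z j
  | n, z, 0 => by simp
  | 0, z, j + 1 => by rw [visA_zero_succ]; exact visA_nonneg _ _ _
  | n + 1, z, j + 1 => by
    rw [visA_succ_succ, visA_succ_succ]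
    refine mul_le_mul_of_nonneg_left (Finset.sum_le_sum fun a _ => Finset.sum_le_sum fun a' _ => ?_)
      (by positivity)
    split_ifs
    · exact visA_le_succ n _ _
    · exact visA_le_succ n _ _

/-- Monotone in time. [folklore] -/
theorem visA_mono (z : Site d) (j : ℕ) : Monotone fun n => visA d n z j :=
  monotone_nat_of_le_succ fun n => visA_le_succ n z j

/-- Symmetry under coordinate permutations. [folklore] -/
theorem visA_comp_perm (σ : Equiv.Perm (Fin d)) : ∀ (n : ℕ) (z : Site d) (j : ℕ),
    visA d n (z ∘ σ) j = visA d n z j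
  | n, z, 0 => by simp
  | 0, z, j + 1 => by simp
  | n + 1, z, j + 1 => by
    rw [visA_succ_succ, visA_succ_succ]
    congr 1
    refine Eq.trans ?_ (sum_sum_perm σ fun a a' => if IsS2 (z + Pi.single a' 1 - Pi.single a 1)
      then visA d n (z + Pi.single a' 1 - Pi.single a 1) j
      else visA d n (z + Pi.single a' 1 - Pi.single a 1) (j + 1))
    refine Finset.sum_congr rfl fun a _ => Finset.sum_congr rfl fun a' _ => ?_
    rw [step_comp_perm]
    simp only [isS2_comp_perm_iff, visA_comp_perm σ n]

/-- All `S₂` states have the same visit distribution. [folklore] -/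
theorem visA_eq_of_isS2 {s s' : Site d} (hs : IsS2 s) (hs' : IsS2 s') (n j : ℕ) :
    visA d n s' j = visA d n s j := by
  obtain ⟨σ, rfl⟩ := exists_perm_of_isS2 hs hs'
  exact visA_comp_perm σ n s j

/-! ### `E_z #O_n = Σ_j P_z(#O_n ≥ j)` -/

/-- `E_z #{1 ≤ k ≤ n : D_k ∈ S₂}`. [cite: BockEtAl2020, §4 (`E #O_n`)] -/
def esum (d n : ℕ) (z : Site d) : ℝ := ∑ k ∈ range n, iterAvg d indS2 (k + 1) z

/-- `osum d n = esum d n 0`. [folklore] -/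
theorem osum_eq_esum (n : ℕ) : osum d n = esum d n (0 : Site d) := rfl

/-- First-step recursion of `esum`. [folklore] -/
theorem esum_succ (n : ℕ) (z : Site d) :
    esum d (n + 1) z = ((d : ℝ) ^ 2)⁻¹ * ∑ a : Fin d, ∑ a' : Fin d,
      (indS2 (z + Pi.single a' 1 - Pi.single a 1) + esum d n (z + Pi.single a' 1 - Pi.single a 1)) := by
  rw [esum, Finset.sum_range_succ', Finset.sum_congr rfl fun k _ => iterAvg_succ indS2 (k + 1) z,
    iterAvg_succ indS2 0 z]
  simp only [iterAvg_zero]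
  rw [← Finset.mul_sum, ← mul_add]
  congr 1
  rw [Finset.sum_comm, ← Finset.sum_add_distrib]
  refine Finset.sum_congr rfl fun a _ => ?_
  rw [Finset.sum_comm, ← Finset.sum_add_distrib]
  refine Finset.sum_congr rfl fun a' _ => ?_
  rw [esum, add_comm]

/-- **`E_z #O_n = Σ_{j=1}^{n} P_z(#O_n ≥ j)`**. [cite: BockEtAl2020, §4 (4.6)] -/
theorem sum_visA_eq_esum : ∀ (n : ℕ) (z : Site d),
    ∑ j ∈ range n, visA d n z (j + 1) = esum d n z
  | 0, z => by simp [esum]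
  | n + 1, z => by
    rw [esum_succ, Finset.sum_congr rfl fun j _ => visA_succ_succ n z j, sum_range_avg]
    congr 1
    refine Finset.sum_congr rfl fun a _ => Finset.sum_congr rfl fun a' _ => ?_
    set y := z + Pi.single a' 1 - Pi.single a 1 with hy
    by_cases hS : IsS2 y
    · simp only [if_pos hS, indS2]
      rw [Finset.sum_range_succ', visA_zero_right, sum_visA_eq_esum n y, add_comm]
    · simp only [if_neg hS, indS2, zero_add]
      rw [Finset.sum_range_succ, visA_eq_zero_of_lt n y (n + 1) (Nat.lt_succ_self n), add_zero,
        sum_visA_eq_esum n y]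

/-! ### The lower renewal bound -/

/-- **Lower renewal bound**: if `π ≤ P_s(#O_N ≥ 1)` for all `s ∈ S₂`, then for all `n, z, j`,
`P_z(#O_{n+N} ≥ j+2) ≥ P_z(#O_n ≥ j+1) · π` (after the `(j+1)`-st visit the chain sits in `S₂` and
returns within `N` more steps with probability `≥ π`). [cite: BockEtAl2020, §4 (4.6)] -/
theorem visA_lower {N : ℕ} {π : ℝ} (hπ0 : 0 ≤ π) (hπ : ∀ s : Site d, IsS2 s → π ≤ visA d N s 1) :
    ∀ (n : ℕ) (z : Site d) (j : ℕ), visA d n z (j + 1) * π ≤ visA d (n + N) z (j + 2)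
  | 0, z, j => by
    rw [visA_zero_succ, zero_mul]
    exact visA_nonneg _ _ _
  | n + 1, z, j => by
    rw [show n + 1 + N = (n + N) + 1 by omega, visA_succ_succ, visA_succ_succ, mul_comm,
      ← mul_assoc, mul_comm π, mul_assoc, Finset.mul_sum]
    refine mul_le_mul_of_nonneg_left (Finset.sum_le_sum fun a _ => ?_) (by positivity)
    rw [Finset.mul_sum]
    refine Finset.sum_le_sum fun a' _ => ?_
    set y := z + Pi.single a' 1 - Pi.single a 1 with hy
    split_ifs with hS
    · cases j with
      | zero =>
        rw [visA_zero_right, mul_one]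
        exact (hπ y hS).trans (visA_mono y 1 (Nat.le_add_left N n))
      | succ j =>
        rw [mul_comm]
        exact visA_lower hπ0 hπ n y j
    · rw [mul_comm]
      exact visA_lower hπ0 hπ n y j

/-- From the origin the first visit to `S₂` is missed only by staying at `0`:
`P_0(#O_M ≥ 1) = 1 - d^{-M}`. [cite: BockEtAl2020, §4 (`P(h_k = 2 for some k ≥ 1) = 1`)] -/
theorem visA_origin_one (hd : 1 ≤ d) : ∀ M : ℕ, visA d M (0 : Site d) 1 = 1 - (1 / (d : ℝ)) ^ M
  | 0 => by simp
  | M + 1 => by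
    have hd0 : (d : ℝ) ≠ 0 := by exact_mod_cast (show d ≠ 0 by omega)
    rw [visA_succ_succ]
    have hterm : ∀ a a' : Fin d,
        (if IsS2 ((0 : Site d) + Pi.single a' 1 - Pi.single a 1) then
            visA d M ((0 : Site d) + Pi.single a' 1 - Pi.single a 1) 0
          else visA d M ((0 : Site d) + Pi.single a' 1 - Pi.single a 1) 1) =
          1 - (if a = a' then (1 / (d : ℝ)) ^ M else 0) := by
      intro a a'
      rw [zero_add]
      by_cases h : a = a'
      · subst h
        rw [sub_self, if_neg (fun h' => IsS2.ne_zero h' rfl), if_pos rfl, visA_origin_one hd M]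
      · rw [if_pos (isS2_single_sub_single (Ne.symm h)), visA_zero_right, if_neg h, sub_zero]
    rw [Finset.sum_congr rfl fun a _ => Finset.sum_congr rfl fun a' _ => hterm a a']
    simp only [Finset.sum_sub_distrib, Finset.sum_const, Finset.card_univ, Fintype.card_fin,
      nsmul_eq_mul, Finset.sum_ite_eq, Finset.mem_univ, if_true]
    rw [pow_succ (1 / (d : ℝ)) M]
    set X : ℝ := (1 / (d : ℝ)) ^ M
    field_simp

/-- Iterating the lower renewal bound from the origin:
`P_0(#O_{M + jN} ≥ j+1) ≥ (1 - d^{-M}) π^j`. [cite: BockEtAl2020, §4 (4.6)] -/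
theorem visA_origin_ge (hd : 1 ≤ d) {N : ℕ} {π : ℝ} (hπ0 : 0 ≤ π)
    (hπ : ∀ s : Site d, IsS2 s → π ≤ visA d N s 1) (M : ℕ) :
    ∀ j : ℕ, (1 - (1 / (d : ℝ)) ^ M) * π ^ j ≤ visA d (M + j * N) (0 : Site d) (j + 1)
  | 0 => by rw [pow_zero, mul_one, zero_mul, add_zero, visA_origin_one hd M]
  | j + 1 => by
    calc (1 - (1 / (d : ℝ)) ^ M) * π ^ (j + 1) = ((1 - (1 / (d : ℝ)) ^ M) * π ^ j) * π := by ring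
      _ ≤ visA d (M + j * N) 0 (j + 1) * π :=
          mul_le_mul_of_nonneg_right (visA_origin_ge hd hπ0 hπ M j) hπ0
      _ ≤ visA d (M + j * N + N) 0 (j + 2) := visA_lower hπ0 hπ _ 0 j
      _ = visA d (M + (j + 1) * N) 0 (j + 1 + 1) := by rw [add_mul, one_mul, add_assoc]

/-- **`Σ_{j<J} π^j ≤ O⁺`**: geometric lower bounds on the visit probabilities against an upper
bound `O⁺` on `E_0 #O_n` (BDNS: `E #O = 1/(1 - p₂)`). [cite: BockEtAl2020, §4 (4.4)–(4.6)] -/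
theorem geom_sum_visA_le (hd : 2 ≤ d) {N : ℕ} (hN : 1 ≤ N) {π O : ℝ} (hπ0 : 0 ≤ π)
    (hπ : ∀ s : Site d, IsS2 s → π ≤ visA d N s 1) (hO : ∀ n, osum d n ≤ O) (J : ℕ) :
    ∑ j ∈ range J, π ^ j ≤ O := by
  have hd1 : 1 ≤ d := by omega
  have hdr : (1 : ℝ) < d := by exact_mod_cast hd
  -- for every `M`: `(1 - d^{-M}) Σ_{j<J} π^j ≤ O`
  have key : ∀ M : ℕ, (1 - (1 / (d : ℝ)) ^ M) * ∑ j ∈ range J, π ^ j ≤ O := by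
    intro M
    set n := M + J * N with hn
    calc (1 - (1 / (d : ℝ)) ^ M) * ∑ j ∈ range J, π ^ j
        = ∑ j ∈ range J, (1 - (1 / (d : ℝ)) ^ M) * π ^ j := Finset.mul_sum _ _ _
      _ ≤ ∑ j ∈ range J, visA d n 0 (j + 1) := by
          refine Finset.sum_le_sum fun j hj => (visA_origin_ge hd1 hπ0 hπ M j).trans ?_
          refine visA_mono 0 (j + 1) ?_
          rw [Finset.mem_range] at hj
          show M + j * N ≤ M + J * N
          exact Nat.add_le_add_left (Nat.mul_le_mul_right _ hj.le) _
      _ ≤ ∑ j ∈ range n, visA d n 0 (j + 1) := by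
          have hJn : J ≤ n := (Nat.le_mul_of_pos_right _ hN).trans (Nat.le_add_left _ _)
          exact Finset.sum_le_sum_of_subset_of_nonneg
            (fun j hj => Finset.mem_range.2 ((Finset.mem_range.1 hj).trans_le hJn))
            fun j _ _ => visA_nonneg _ _ _
      _ = osum d n := by rw [sum_visA_eq_esum, osum_eq_esum]
      _ ≤ O := hO n
  -- let `M → ∞`
  have hS0 : 0 ≤ ∑ j ∈ range J, π ^ j := Finset.sum_nonneg fun j _ => pow_nonneg hπ0 j
  by_contra hcon
  push Not at hcon
  -- `O < S`; pick `M` with `(1/d)^M < 1 - O/S`... via `(1/d)^M S < S - O`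
  have hSpos : 0 < ∑ j ∈ range J, π ^ j := by
    have := hO 0
    simp [osum] at this
    linarith
  obtain ⟨M, hM⟩ := exists_pow_lt_of_lt_one (div_pos (sub_pos.2 hcon) hSpos)
    (show 1 / (d : ℝ) < 1 by rw [div_lt_one (by linarith)]; exact hdr)
  have h1 := key M
  have h2 : (1 / (d : ℝ)) ^ M * ∑ j ∈ range J, π ^ j < ∑ j ∈ range J, π ^ j - O := by
    have := mul_lt_mul_of_pos_right hM hSpos
    rwa [div_mul_cancel₀ _ hSpos.ne'] at this
  nlinarith

/-- An upper bound on all `E_0 #O_n` is at least `1` (`E_0 #O_n ≥ P_0(#O_n ≥ 1) = 1 - d^{-n}`).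
[folklore] -/
theorem one_le_of_osum_le (hd : 2 ≤ d) {O : ℝ} (hO : ∀ n, osum d n ≤ O) : 1 ≤ O := by
  have hd1 : 1 ≤ d := by omega
  have hdr : (1 : ℝ) < d := by exact_mod_cast hd
  have hlt : 1 / (d : ℝ) < 1 := by rw [div_lt_one (by linarith)]; exact hdr
  have key : ∀ n, 1 - (1 / (d : ℝ)) ^ n ≤ O := by
    intro n
    cases n with
    | zero => simpa [osum] using hO 0
    | succ n =>
      calc 1 - (1 / (d : ℝ)) ^ (n + 1) = visA d (n + 1) 0 1 := (visA_origin_one hd1 (n + 1)).symm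
        _ = visA d (n + 1) (0 : Site d) (0 + 1) := rfl
        _ ≤ ∑ j ∈ range (n + 1), visA d (n + 1) (0 : Site d) (j + 1) :=
            Finset.single_le_sum (f := fun j => visA d (n + 1) (0 : Site d) (j + 1))
              (fun j _ => visA_nonneg _ _ _) (Finset.mem_range.2 (Nat.succ_pos n))
        _ = osum d (n + 1) := by rw [sum_visA_eq_esum, osum_eq_esum]
        _ ≤ O := hO (n + 1)
  refine le_of_forall_pos_lt_add fun ε hε => ?_
  obtain ⟨n, hn⟩ := exists_pow_lt_of_lt_one hε hlt
  linarith [key n]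

/-- **`P_s(#O_N ≥ 1) ≤ 1 - 1/O⁺`** for `s ∈ S₂` (BDNS: `p₂ = 1 - 1/E#O`). [cite: BockEtAl2020, §4 Lemma 4.1 (item 1)] -/
theorem visA_S2_le (hd : 2 ≤ d) {O : ℝ} (hO : ∀ n, osum d n ≤ O) (N : ℕ) {s : Site d} (hs : IsS2 s) :
    visA d N s 1 ≤ 1 - 1 / O := by
  have hO1 := one_le_of_osum_le hd hO
  rcases Nat.eq_zero_or_pos N with rfl | hN
  · rw [visA_zero_succ, sub_nonneg, div_le_one (by linarith)]
    exact hO1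
  set π := visA d N s 1 with hπ
  have hπ0 : 0 ≤ π := visA_nonneg _ _ _
  have hπS : ∀ s' : Site d, IsS2 s' → π ≤ visA d N s' 1 := fun s' hs' =>
    (visA_eq_of_isS2 hs hs' N 1).ge
  have hgeom := geom_sum_visA_le hd hN hπ0 hπS hO
  -- `π < 1`
  have hπ1 : π < 1 := by
    by_contra h
    push Not at h
    obtain ⟨J, hJ⟩ := exists_nat_gt O
    have h1 : (J : ℝ) ≤ ∑ j ∈ range J, π ^ j := by
      calc (J : ℝ) = ∑ _j ∈ range J, (1 : ℝ) := by simp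
        _ ≤ ∑ j ∈ range J, π ^ j := Finset.sum_le_sum fun j _ => one_le_pow₀ h
    linarith [hgeom J]
  -- `1/(1 - π) ≤ O` from the partial sums `(1 - π^J)/(1 - π) ≤ O` and `π^J → 0`
  have hO' : 1 / (1 - π) ≤ O := by
    refine le_of_forall_pos_lt_add fun ε hε => ?_
    have h1π : 0 < 1 - π := sub_pos.2 hπ1
    obtain ⟨J, hJ⟩ := exists_pow_lt_of_lt_one (mul_pos hε h1π) hπ1
    have hg := hgeom J
    rw [geom_sum_eq hπ1.ne J] at hg
    rw [div_le_iff_of_neg (sub_neg.2 hπ1)] at hg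
    rw [div_lt_iff₀ h1π]
    nlinarith
  have h1π : 0 < 1 - π := sub_pos.2 hπ1
  have hOpos : 0 < O := lt_of_lt_of_le (div_pos one_pos h1π) hO'
  rw [div_le_iff₀ h1π] at hO'
  rw [le_sub_comm, div_le_iff₀ hOpos]
  linarith

/-! ### From `visA` to the first-visit probability `hS` -/

/-- `hS ≤ visA (·) (·) 1` (the first visit to `{0} ∪ S₂` being in `S₂` implies a visit to `S₂`).
[folklore] -/
theorem hS_le_visA : ∀ (n : ℕ) (z : Site d), hS d n z ≤ visA d n z 1
  | 0, z => by simp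
  | n + 1, z => by
    rw [hS_succ, visA_succ_succ]
    refine mul_le_mul_of_nonneg_left (Finset.sum_le_sum fun a _ => Finset.sum_le_sum fun a' _ => ?_)
      (by positivity)
    split_ifs with h1 h2
    · rw [visA_zero_right]
    · exact visA_nonneg _ _ _
    · exact hS_le_visA n _

/-- `hS` is non-decreasing in `n`. [folklore] -/
theorem hS_le_succ : ∀ (n : ℕ) (z : Site d), hS d n z ≤ hS d (n + 1) z
  | 0, z => by rw [hS_zero]; exact hS_nonneg _ _
  | n + 1, z => by
    rw [hS_succ, hS_succ]
    refine mul_le_mul_of_nonneg_left (Finset.sum_le_sum fun a _ => Finset.sum_le_sum fun a' _ => ?_)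
      (by positivity)
    split_ifs
    · exact le_rfl
    · exact le_rfl
    · exact hS_le_succ n _

/-- `hS` is monotone in time. [folklore] -/
theorem hS_mono (z : Site d) : Monotone fun n => hS d n z :=
  monotone_nat_of_le_succ fun n => hS_le_succ n z

/-- **Returns through `0` are extra**: for `s ∈ S₂`,
`hS d (n+1) s + (1/d²) P_0(#O_n ≥ 1) ≤ P_s(#O_{n+1} ≥ 1)` (the step `(a, a')` undoing `s` leads to `0`,
from where `S₂` is visited with probability `P_0(#O_n ≥ 1)`; this is BDNS's `p₂ - 1/d²` bookkeeping).
[cite: BockEtAl2020, §3 (3.14)] -/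
theorem hS_add_le_visA (n : ℕ) {s : Site d} (hs : IsS2 s) :
    hS d (n + 1) s + (1 / (d : ℝ) ^ 2) * visA d n (0 : Site d) 1 ≤ visA d (n + 1) s 1 := by
  obtain ⟨i, j, hij, rfl⟩ := hs
  rw [hS_succ, visA_succ_succ, one_div, ← mul_add]
  refine mul_le_mul_of_nonneg_left ?_ (by positivity)
  -- the difference of the two sums is a sum of nonnegative terms containing the term at `(i, j)`
  have hdiff : ∀ a a' : Fin d, 0 ≤
      (if IsS2 (Pi.single i 1 - Pi.single j 1 + Pi.single a' 1 - Pi.single a 1 : Site d) then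
          visA d n (Pi.single i 1 - Pi.single j 1 + Pi.single a' 1 - Pi.single a 1) 0
        else visA d n (Pi.single i 1 - Pi.single j 1 + Pi.single a' 1 - Pi.single a 1) 1) -
      (if IsS2 (Pi.single i 1 - Pi.single j 1 + Pi.single a' 1 - Pi.single a 1 : Site d) then (1 : ℝ)
        else if Pi.single i 1 - Pi.single j 1 + Pi.single a' 1 - Pi.single a 1 = (0 : Site d) then 0
        else hS d n (Pi.single i 1 - Pi.single j 1 + Pi.single a' 1 - Pi.single a 1)) := by
    intro a a'
    split_ifs with h1 h2
    · rw [visA_zero_right, sub_self]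
    · rw [sub_zero]; exact visA_nonneg _ _ _
    · exact sub_nonneg.2 (hS_le_visA n _)
  have hkey : (if IsS2 (Pi.single i 1 - Pi.single j 1 + Pi.single j 1 - Pi.single i 1 : Site d) then
          visA d n (Pi.single i 1 - Pi.single j 1 + Pi.single j 1 - Pi.single i 1) 0
        else visA d n (Pi.single i 1 - Pi.single j 1 + Pi.single j 1 - Pi.single i 1) 1) -
      (if IsS2 (Pi.single i 1 - Pi.single j 1 + Pi.single j 1 - Pi.single i 1 : Site d) then (1 : ℝ)
        else if Pi.single i 1 - Pi.single j 1 + Pi.single j 1 - Pi.single i 1 = (0 : Site d) then 0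
        else hS d n (Pi.single i 1 - Pi.single j 1 + Pi.single j 1 - Pi.single i 1)) =
      visA d n 0 1 := by
    have h0 : (Pi.single i 1 - Pi.single j 1 + Pi.single j 1 - Pi.single i 1 : Site d) = 0 := by abel
    rw [h0, if_neg (fun h => IsS2.ne_zero h rfl), if_neg (fun h => IsS2.ne_zero h rfl), if_pos rfl,
      sub_zero]
  rw [← sub_nonneg]
  have : ∑ a : Fin d, ∑ a' : Fin d,
        (if IsS2 (Pi.single i 1 - Pi.single j 1 + Pi.single a' 1 - Pi.single a 1 : Site d) then
            visA d n (Pi.single i 1 - Pi.single j 1 + Pi.single a' 1 - Pi.single a 1) 0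
          else visA d n (Pi.single i 1 - Pi.single j 1 + Pi.single a' 1 - Pi.single a 1) 1) -
      (∑ a : Fin d, ∑ a' : Fin d,
        (if IsS2 (Pi.single i 1 - Pi.single j 1 + Pi.single a' 1 - Pi.single a 1 : Site d) then (1 : ℝ)
          else if Pi.single i 1 - Pi.single j 1 + Pi.single a' 1 - Pi.single a 1 = (0 : Site d) then 0
          else hS d n (Pi.single i 1 - Pi.single j 1 + Pi.single a' 1 - Pi.single a 1)) +
        visA d n 0 1) =
      ∑ a : Fin d, ∑ a' : Fin d,
        ((if IsS2 (Pi.single i 1 - Pi.single j 1 + Pi.single a' 1 - Pi.single a 1 : Site d) then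
            visA d n (Pi.single i 1 - Pi.single j 1 + Pi.single a' 1 - Pi.single a 1) 0
          else visA d n (Pi.single i 1 - Pi.single j 1 + Pi.single a' 1 - Pi.single a 1) 1) -
        (if IsS2 (Pi.single i 1 - Pi.single j 1 + Pi.single a' 1 - Pi.single a 1 : Site d) then (1 : ℝ)
          else if Pi.single i 1 - Pi.single j 1 + Pi.single a' 1 - Pi.single a 1 = (0 : Site d) then 0
          else hS d n (Pi.single i 1 - Pi.single j 1 + Pi.single a' 1 - Pi.single a 1))) -
        visA d n 0 1 := by
    simp only [Finset.sum_sub_distrib]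
    ring
  rw [this, sub_nonneg, ← hkey]
  exact Finset.single_le_sum (f := fun a => ∑ a' : Fin d, _) (fun a _ => Finset.sum_nonneg fun a' _ =>
    hdiff a a') (Finset.mem_univ i) |>.trans' (Finset.single_le_sum (fun a' _ => hdiff i a')
      (Finset.mem_univ j))

/-- **BDNS Lemma 4.1, item 1 (finite form): the renewal parameter.**  If `P_0(τ ≤ n) ≤ ρ` for all
`n` with `1/d < ρ < 1`, then for every `N` and every `s ∈ S₂`,
`hS d N s ≤ 1 - (1 - ρ)/(d²ρ - d) - 1/d² = t(ρ) - 1/d²`. [cite: BockEtAl2020, §4 Lemma 4.1 (item 1), §3 (3.14)] -/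
theorem hS_le_of_retProb_le (hd : 2 ≤ d) {ρ : ℝ} (hρ : ∀ n, retProb d n (0 : Site d) ≤ ρ)
    (hρd : 1 / (d : ℝ) < ρ) (hρ1 : ρ < 1) (N : ℕ) {s : Site d} (hs : IsS2 s) :
    hS d N s ≤ 1 - (1 - ρ) / ((d : ℝ) ^ 2 * ρ - d) - 1 / (d : ℝ) ^ 2 := by
  have hd1 : 1 ≤ d := by omega
  have hdr : (1 : ℝ) < d := by exact_mod_cast hd
  have hdpos : (0 : ℝ) < d := by linarith
  -- the bound on `E_0 #O_n`
  set O : ℝ := ((d : ℝ) ^ 2 - d) * (ρ / (1 - ρ)) - d with hOdef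
  have hO : ∀ n, osum d n ≤ O := fun n => osum_le hd1 hρ hρ1 n
  have hdρ : 0 < (d : ℝ) ^ 2 * ρ - d := by
    have : 1 < (d : ℝ) * ρ := by rwa [div_lt_iff₀ hdpos, mul_comm] at hρd
    nlinarith
  have hOeq : 1 / O = (1 - ρ) / ((d : ℝ) ^ 2 * ρ - d) := by
    rw [hOdef]
    have h1ρ : (1 : ℝ) - ρ ≠ 0 := (sub_pos.2 hρ1).ne'
    field_simp
    ring
  -- `hS N s ≤ hS (M+1) s ≤ visA (M+1) s 1 - d^{-2} visA M 0 1 ≤ (1 - 1/O) - d^{-2}(1 - d^{-M})`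
  have key : ∀ M : ℕ, N ≤ M + 1 →
      hS d N s ≤ 1 - 1 / O - 1 / (d : ℝ) ^ 2 + (1 / (d : ℝ) ^ 2) * (1 / (d : ℝ)) ^ M := by
    intro M hM
    have h1 : hS d N s ≤ hS d (M + 1) s := hS_mono s hM
    have h2 := hS_add_le_visA M hs
    have h3 := visA_S2_le hd hO (M + 1) hs
    have h4 := visA_origin_one hd1 M
    rw [h4] at h2
    nlinarith [h1, h2, h3]
  rw [← hOeq]
  refine le_of_forall_pos_lt_add fun ε hε => ?_
  have hlt : 1 / (d : ℝ) < 1 := by rw [div_lt_one hdpos]; exact hdr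
  obtain ⟨M, hM⟩ := exists_pow_lt_of_lt_one (mul_pos hε (pow_pos hdpos 2)) hlt
  have hM' : (1 / (d : ℝ)) ^ (M + N) < ε * (d : ℝ) ^ 2 :=
    (pow_le_pow_of_le_one (by positivity) hlt.le (Nat.le_add_right M N)).trans_lt hM
  have h := key (M + N) (by omega)
  have h5 : (1 / (d : ℝ) ^ 2) * (1 / (d : ℝ)) ^ (M + N) < ε := by
    rw [one_div, inv_mul_lt_iff₀ (pow_pos hdpos 2)]
    linarith
  linarith

end Literature.Probability.Percolation

end
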